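import Mathlib
import HarnessLib
import Summits.ResolutionOfSingularities.ResolutionOfSingularities.Theorems.WildQuotientsWildQuotientResolutionS1aNodeAtlas
import Literature.AlgebraicGeometry.Resolution.KiralyLutkebohmert

/-!
# S1a — (T2e) KILL CENTRES: admissible centres whose centre charts satisfy the ONE-SHOT KILL hypotheses

[OURS · L1 W4.5c · lead-1 g7; plan-1 STRATEGY-DESIGN v2 §3 (R0) / T2-THEOREM-SHEET §11] — NOT statements of the manuscript;
counted 0; AI-level work, weaker than expert review. Crux stmt-ResolutionOfSingularities-17941, line `s1a-logminvertex` v6, stub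
`stub_winningStrategy`. DEFINITIONS + their trivial projections only.

* `IsKillCentreChart p ρ g₀ 𝒦 d O` — `IsCentreChart` (H4b `…S1aNodeAtlas`) with the SAME data `(B, 𝒜, σ, e; f, δ, w; c)` and, in
  addition, the ring-level ONE-SHOT KILL hypotheses of `OneShotKill.augmentationIdeal_sigmaChart_eq_span_s` (`…S1aOneShotKillChart`):
  the centre generators lie in the augmentation ideal (`f i ∈ I_σ`), gr-triviality `σ y − y ∈ K 1`, DEPTH `σ f_i − f_i ∈ K (w_i + 1)`,
  and HEADS-or-UNIT-SUCCESSORS (`w_i = 1`, or `w_i = w_h + 1` with `σ f_h − f_h ≡ u f_i (mod K (w_h + 2))`, `u` a unit mod `K 1`).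
  On every chart of the weighted blow-up of such a centre the lifted automorphism is Király–Lütkebohmert-KILLED (`I_{σʼ} = (s)`).
* `IsKillCentre p ρ g₀ 𝒦 d` — a `G`-stable Rees filtration covered by KILL-centre charts and idle charts (as `IsAdmissibleCentre`).
* `isCentreChart_of_isKillCentreChart`, `isAdmissibleCentre_of_isKillCentre` — forgetful projections.
-/

set_option linter.dupNamespace false

noncomputable section

open CategoryTheory AlgebraicGeometry TopologicalSpace
open Literature.AlgebraicGeometry.Resolution Literature.AlgebraicGeometry.RelativeSpec
open Summit.ResolutionOfSingularities.ResolutionOfSingularities.Theorems.WildQuotientResolution.S1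
open Summit.ResolutionOfSingularities.ResolutionOfSingularities.Theorems.WildQuotientResolution.S1.ProducerStep

namespace Summit.ResolutionOfSingularities.ResolutionOfSingularities.Theorems.WildQuotientResolution.S1.NodeAtlas

universe u

section Centre

variable (p : ℕ) {V Y : Scheme.{u}} {q : V ⟶ Y} {G : Type*} [Group G] (ρ : ActionOver q G) (g₀ : G)

/-- **KILL-centre chart**: the centre data of `IsCentreChart` — node `(B, 𝒜, σ, e)` of the chart, a K1′-REGULAR `σ`-ADAPTED
HOMOGENEOUS weighted centre `(f, w)` with `0 < c` whose degree-0 trace is `𝒦` on `Γ(V, O)` and Veronese degree `d` — satisfying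
moreover the ONE-SHOT KILL hypotheses: `f i ∈ augmentationIdeal σ`, `σ y − y ∈ K 1` for all `y`, depth `σ f_i − f_i ∈ K (w_i + 1)`,
and heads-or-unit-successors. [OURS · L1 W4.5c] -/
def IsKillCentreChart (𝒦 : ReesFiltration V) (d : ℕ) (O : ρ.StableAffineOpens) : Prop :=
  ∃ (hO : IsAffineOpen O.1) (m : ℕ) (r : Fin m → ℕ) (B : Type u) (_ : CommRing B)
    (𝒜 : (Π j : Fin m, ZMod (r j)) → AddSubgroup B) (_ : GradedRing 𝒜) (σ : B ≃+* B)
    (e : Γ(V, O.1) ≃+* ↥(𝒜 0)),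
    IsTameNode p B 𝒜 σ ∧
    (∀ t : Γ(V, O.1),
      ((e ((ρ.aut g₀⁻¹).hom.appLE O.1 O.1 (O.2.1 g₀⁻¹).ge t) : ↥(𝒜 0)) : B) = σ ((e t : ↥(𝒜 0)) : B)) ∧
    ∃ (c : ℕ) (f : Fin c → B) (δ : Fin c → Π j : Fin m, ZMod (r j)) (w : Fin c → ℕ),
      0 < c ∧ (∀ i, f i ∈ 𝒜 (δ i)) ∧ (∀ i, 0 < w i) ∧
      RingTheory.Sequence.IsRegular B (List.ofFn f) ∧ IsRegularRing (B ⧸ Ideal.span (Set.range f)) ∧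
      (∀ n : ℕ, ((weightedFiltration f w).ideal n).map (σ : B →+* B) ≤ (weightedFiltration f w).ideal n) ∧
      (∀ n : ℕ, (𝒦.filtration ⟨O.1, hO⟩).ideal n =
        ((CoarseChart.traceFiltration 𝒜 f w).ideal n).comap (e : Γ(V, O.1) →+* ↥(𝒜 0))) ∧
      CoarseChart.VeroneseNormalised 𝒜 f w d ∧
      -- the ONE-SHOT KILL hypotheses (T2a/T2c, depth form)
      (∀ i, f i ∈ augmentationIdeal σ) ∧
      (∀ y : B, σ y - y ∈ (weightedFiltration f w).ideal 1) ∧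
      (∀ i, σ (f i) - f i ∈ (weightedFiltration f w).ideal (w i + 1)) ∧
      (∀ i, w i = 1 ∨ ∃ (h : Fin c) (u : B), w i = w h + 1 ∧
        IsUnit (Ideal.Quotient.mk ((weightedFiltration f w).ideal 1) u) ∧
        σ (f h) - f h - u * f i ∈ (weightedFiltration f w).ideal (w h + 2))

/-- **KILL centre** with Veronese degree `d`: a `G`-STABLE Rees filtration `𝒦` on `V` such that every point lies in a node chart which
is EITHER a KILL-centre chart OR idle. [OURS · L1 W4.5c] -/
def IsKillCentre (𝒦 : ReesFiltration V) (d : ℕ) : Prop :=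
  0 < d ∧ (∀ (g : G) (n : ℕ), (𝒦.ideal n).comap (ρ.aut g).hom = 𝒦.ideal n) ∧
    ∀ v : V, ∃ O : ρ.StableAffineOpens, v ∈ O.1 ∧ (IsKillCentreChart p ρ g₀ 𝒦 d O ∨ IsIdleChart p ρ g₀ 𝒦 O)

variable {p ρ g₀}

/-- A kill-centre chart is a centre chart (forget the one-shot hypotheses). -/
theorem isCentreChart_of_isKillCentreChart {𝒦 : ReesFiltration V} {d : ℕ} {O : ρ.StableAffineOpens}
    (h : IsKillCentreChart p ρ g₀ 𝒦 d O) : IsCentreChart p ρ g₀ 𝒦 d O := by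
  obtain ⟨hO, m, r, B, _, 𝒜, _, σ, e, hnode, hσ, c, f, δ, w, hc, hf, hw, hK1, hK1', hσJ, h𝒦, hver, -, -, -, -⟩ := h
  exact ⟨hO, m, r, B, inferInstance, 𝒜, inferInstance, σ, e, hnode, hσ, c, f, δ, w, hc, hf, hw, hK1, hK1', hσJ, h𝒦, hver⟩

/-- A kill centre is an admissible centre. -/
theorem isAdmissibleCentre_of_isKillCentre {𝒦 : ReesFiltration V} {d : ℕ} (h : IsKillCentre p ρ g₀ 𝒦 d) :
    IsAdmissibleCentre p ρ g₀ 𝒦 d :=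
  ⟨h.1, h.2.1, fun v => (h.2.2 v).imp fun _ hO => ⟨hO.1, hO.2.imp_left isCentreChart_of_isKillCentreChart⟩⟩

end Centre

end Summit.ResolutionOfSingularities.ResolutionOfSingularities.Theorems.WildQuotientResolution.S1.NodeAtlas

end
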